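import Mathlib
import Summits.ResolutionOfSingularities.ResolutionOfSingularities.Theorems.SyzygyFlatteningDefs
import Literature.AlgebraicGeometry.Resolution.ExcellentRings
import Literature.AlgebraicGeometry.Resolution.RegularLocalRingsFlatDescent
import HarnessLib

/-!
# The regular locus of `R[X]` over a Noetherian ring (`stub_regularLocus_polynomial`)

Crux `HigherRankTermination` (stmt-ResolutionOfSingularities-17045), line `birth`, registered
stub `stub_regularLocus_polynomial` of the base-change line `(k, K) ↦ (k(X), K(X))`: the pure
commutative algebra behind "the non-regular locus of a model commutes with the base change".

For a Noetherian ring `R` and a prime `P` of `R[X]` over `𝔮 = P ∩ R`, **`R[X]_P` is a regular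
local ring iff `R_𝔮 is`**:
* (⇐, ascent — Matsumura, Thm. 19.5) `R[X]_P` is the localisation of `R_𝔮[X]` at the prime
  `P R_𝔮[X]`, which contracts to the maximal ideal of `R_𝔮`; this is Mathlib's
  `Polynomial.isRegularLocalRing_localization_atPrime_of_comap_eq_maximalIdeal`, reached by the
  reduction in Mathlib's `Polynomial.isRegularRing_of_isRegularRing` (copied here with the
  regularity of `R_𝔮` in place of that of `R`);
* (⇒, descent — Matsumura, Thm. 23.7 (i)) `R_𝔮 → R[X]_P` is a flat local homomorphism
  (`R → R[X]` is free; Mathlib `Localization.AtPrime.algebraOfLiesOver`), so regularity descends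
  (tree `IsRegularLocalRing.of_flat_of_isLocalHom`, `RegularLocalRingsFlatDescent.lean`).

Consequently `Sing(R[X]) = Reg(R[X])ᶜ` is the preimage of `Sing(R)` under `Spec R[X] → Spec R`
(`compl_regularLocus_polynomial`), and **if `Sing(R) = V(I)` is closed** (`I` its radical
vanishing ideal) then `Sing(R[X]) = V(I R[X])` has vanishing ideal `√(I R[X]) = I R[X]`, since
`R[X] ⧸ I R[X] ≃ (R ⧸ I)[X]` is reduced (`isRadical_map_C`,
`vanishingIdeal_compl_regularLocus_polynomial`). The model is the landed
`vanishingIdeal_compl_regularLocus_of_isLocalization` (same statement for localisations).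

## References
* H. Matsumura, *Commutative Ring Theory*, Cambridge Univ. Press (1986), Thm. 19.5 (p. 156),
  Thm. 23.7 (i) (p. 182). [Matsumura1987]
-/

noncomputable section

-- single-problem summit: the doubled namespace component is forced
set_option linter.dupNamespace false

open scoped NNReal

namespace Summit.ResolutionOfSingularities.ResolutionOfSingularities.Theorems.SyzygyFlattening

open IsLocalRing Polynomial Literature.AlgebraicGeometry.Resolution

/-! ## Ascent: `R_𝔮` regular ⟹ `R[X]_P` regular (Matsumura, Thm. 19.5) -/

/-- **Ascent of regularity to `R[X]`** (Matsumura, Thm. 19.5, local form): for a prime `P` of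
`R[X]` over `𝔮 = P ∩ R` with `R` Noetherian, if `R_𝔮` is a regular local ring then so is
`R[X]_P`. `R[X]_P` is the localisation of `R_𝔮[X]` at the prime `P R_𝔮[X]`, which lies over the
maximal ideal of `R_𝔮`, and Mathlib's
`Polynomial.isRegularLocalRing_localization_atPrime_of_comap_eq_maximalIdeal` applies (the
reduction is the one of Mathlib's `Polynomial.isRegularRing_of_isRegularRing`).
[cite: Matsumura1987, Thm. 19.5] -/
theorem isRegularLocalRing_localization_polynomial_of_comap_C {R : Type*} [CommRing R]
    [IsNoetherianRing R] (p : Ideal R[X]) [p.IsPrime]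
    (h : IsRegularLocalRing (Localization.AtPrime (p.comap (C : R →+* R[X])))) :
    IsRegularLocalRing (Localization.AtPrime p) := by
  -- adapted from Mathlib `Polynomial.isRegularRing_of_isRegularRing`
  let q := p.comap C
  let S := (Localization.AtPrime q)[X]
  let pc := Submonoid.map Polynomial.C.toMonoidHom q.primeCompl
  let _ : Algebra R[X] S := Polynomial.algebra R (Localization.AtPrime q)
  have : IsLocalization pc S := Polynomial.isLocalization _ _
  let pS := p.map (algebraMap R[X] S)
  have disj : Disjoint (pc : Set R[X]) (p : Set R[X]) := by
    simpa [pc, q] using! Set.disjoint_image_left.mpr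
      (Set.disjoint_compl_left_iff_subset.mpr (fun _ a ↦ a))
  have : pS.IsPrime := IsLocalization.isPrime_of_isPrime_disjoint pc _ _ ‹_› disj
  have : IsLocalization.AtPrime (Localization.AtPrime pS) p := by
    convert IsLocalization.isLocalization_isLocalization_atPrime_isLocalization pc
      (Localization.AtPrime pS) pS
    exact (IsLocalization.under_map_of_isPrime_disjoint pc _ ‹_› disj).symm
  haveI : IsRegularLocalRing (Localization.AtPrime q) := h
  have eq : Ideal.comap C pS = maximalIdeal (Localization.AtPrime q) := by
    rw [← IsLocalization.map_under q.primeCompl _ (Ideal.comap C pS),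
      ← IsLocalization.map_under q.primeCompl _ (maximalIdeal (Localization.AtPrime q))]
    simp only [Ideal.comap_comap, S, pS]
    rw [← Polynomial.algebraMap_eq (R := Localization.AtPrime q),
      ← IsScalarTower.algebraMap_eq R (Localization.AtPrime q) (Localization.AtPrime q)[X],
      IsScalarTower.algebraMap_eq R R[X] (Localization.AtPrime q)[X], ← Ideal.comap_comap,
      ← Ideal.under_def R[X], IsLocalization.under_map_of_isPrime_disjoint pc _ ‹_› disj]
    simp [q, IsLocalization.AtPrime.under_maximalIdeal (Localization.AtPrime q) q]
  have hreg := isRegularLocalRing_localization_atPrime_of_comap_eq_maximalIdeal _ pS eq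
  exact hreg.of_ringEquiv (IsLocalization.algEquiv p.primeCompl
    (Localization.AtPrime pS) (Localization.AtPrime p)).toRingEquiv

/-! ## Descent: `R[X]_P` regular ⟹ `R_𝔮` regular (Matsumura, Thm. 23.7 (i)) -/

/-- **Descent of regularity from `R[X]_P` to `R_𝔮`** (`𝔮 = P ∩ R`, `R` Noetherian): the
canonical map `R_𝔮 → R[X]_P` is a flat local homomorphism (`R[X]` is free over `R`), so if
`R[X]_P` is regular then so is `R_𝔮` (Matsumura, Thm. 23.7 (i), tree
`IsRegularLocalRing.of_flat_of_isLocalHom`). [cite: Matsumura1987, Thm. 23.7 (i)] -/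
theorem isRegularLocalRing_localization_comap_C_of_polynomial {R : Type*} [CommRing R]
    [IsNoetherianRing R] (P : Ideal R[X]) [P.IsPrime]
    (h : IsRegularLocalRing (Localization.AtPrime P)) :
    IsRegularLocalRing (Localization.AtPrime (P.comap (C : R →+* R[X]))) := by
  haveI : P.LiesOver (P.comap (C : R →+* R[X])) := ⟨rfl⟩
  letI : Algebra (Localization.AtPrime (P.comap (C : R →+* R[X]))) (Localization.AtPrime P) :=
    Localization.AtPrime.algebraOfLiesOver (P.comap (C : R →+* R[X])) P
  haveI : IsLocalHom
      (algebraMap (Localization.AtPrime (P.comap (C : R →+* R[X]))) (Localization.AtPrime P)) :=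
    Localization.isLocalHom_localRingHom _ _ _ _
  exact IsRegularLocalRing.of_flat_of_isLocalHom
    (Localization.AtPrime (P.comap (C : R →+* R[X]))) (Localization.AtPrime P)

/-- **`R[X]_P` is regular iff `R_{P ∩ R}` is** (`R` Noetherian, `P` a prime of `R[X]`):
ascent by Matsumura, Thm. 19.5, descent by Thm. 23.7 (i) along the flat local map
`R_{P ∩ R} → R[X]_P`. [cite: Matsumura1987, Thm. 23.7 (i)] -/
theorem isRegularLocalRing_localization_polynomial_iff {R : Type*} [CommRing R]
    [IsNoetherianRing R] (P : Ideal R[X]) [P.IsPrime] :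
    IsRegularLocalRing (Localization.AtPrime P) ↔
      IsRegularLocalRing (Localization.AtPrime (P.comap (C : R →+* R[X]))) :=
  ⟨isRegularLocalRing_localization_comap_C_of_polynomial P,
    isRegularLocalRing_localization_polynomial_of_comap_C P⟩

/-! ## The non-regular locus of `R[X]` -/

/-- The non-regular locus of `R[X]` (`R` Noetherian) is the preimage of the non-regular locus of
`R` under `Spec R[X] → Spec R`. [folklore] -/
theorem compl_regularLocus_polynomial (R : Type*) [CommRing R] [IsNoetherianRing R] :
    (regularLocus R[X])ᶜ = PrimeSpectrum.comap (C : R →+* R[X]) ⁻¹' (regularLocus R)ᶜ := by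
  ext p
  simp only [Set.mem_compl_iff, Set.mem_preimage, mem_regularLocus, PrimeSpectrum.comap_asIdeal]
  exact not_congr (isRegularLocalRing_localization_polynomial_iff p.asIdeal)

/-- Polynomials over a reduced ring form a reduced ring (a nilpotent polynomial has nilpotent
coefficients, Mathlib `Polynomial.isNilpotent_iff`). [folklore] -/
theorem isReduced_polynomial (R : Type*) [CommRing R] [IsReduced R] : IsReduced R[X] :=
  ⟨fun f hf => Polynomial.ext fun i => by
    simpa using (Polynomial.isNilpotent_iff.mp hf i).eq_zero⟩

/-- The extension `I R[X]` of a radical ideal `I` of `R` is radical: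
`R[X] ⧸ I R[X] ≃ (R ⧸ I)[X]` is reduced. [folklore] -/
theorem isRadical_map_C {R : Type*} [CommRing R] {I : Ideal R} (hI : I.IsRadical) :
    (I.map (C : R →+* R[X])).IsRadical := by
  rw [Ideal.isRadical_iff_quotient_reduced] at hI ⊢
  haveI : IsReduced (R ⧸ I)[X] := isReduced_polynomial (R ⧸ I)
  exact isReduced_of_injective (Ideal.polynomialQuotientEquivQuotientPolynomial I).symm
    (Ideal.polynomialQuotientEquivQuotientPolynomial I).symm.injective

/-- **The ideal of the non-regular locus of `R[X]`**: if the non-regular locus `Reg(R)ᶜ` of the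
Noetherian ring `R` is closed, then the vanishing ideal of `Reg(R[X])ᶜ` is the extension
`I R[X]` of the vanishing ideal `I` of `Reg(R)ᶜ` — `Reg(R)ᶜ = V(I)`, `Reg(R[X])ᶜ = V(I R[X])`
(`compl_regularLocus_polynomial`), and `√(I R[X]) = I R[X]` (`isRadical_map_C`). [folklore] -/
theorem vanishingIdeal_compl_regularLocus_polynomial (R : Type*) [CommRing R]
    [IsNoetherianRing R] (h : IsClosed (regularLocus R)ᶜ) :
    PrimeSpectrum.vanishingIdeal (regularLocus R[X])ᶜ =
      (PrimeSpectrum.vanishingIdeal (regularLocus R)ᶜ).map (C : R →+* R[X]) := by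
  set I : Ideal R := PrimeSpectrum.vanishingIdeal (regularLocus R)ᶜ with hI
  have h1 : (regularLocus R)ᶜ = PrimeSpectrum.zeroLocus (I : Set R) := by
    rw [hI, PrimeSpectrum.zeroLocus_vanishingIdeal_eq_closure, h.closure_eq]
  have h2 : (regularLocus R[X])ᶜ =
      PrimeSpectrum.zeroLocus ((I.map (C : R →+* R[X]) : Ideal R[X]) : Set R[X]) := by
    rw [compl_regularLocus_polynomial, h1, PrimeSpectrum.preimage_comap_zeroLocus,
      ← PrimeSpectrum.zeroLocus_span]
    rfl
  rw [h2, PrimeSpectrum.vanishingIdeal_zeroLocus_eq_radical,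
    (isRadical_map_C (PrimeSpectrum.isRadical_vanishingIdeal _)).radical]

/-! ## The registered stub -/

/-- **STUB `stub_regularLocus_polynomial` (regular locus of a polynomial ring).** For a
Noetherian ring `R`: (1) for every prime `P` of `R[X]`, `R[X]_P` is regular iff `R_{P ∩ R}` is
(ascent: Matsumura, Thm. 19.5; descent: Thm. 23.7 (i) along the flat local map
`R_{P ∩ R} → R[X]_P`); (2) if the non-regular locus of `R` is closed, the vanishing ideal of the
non-regular locus of `R[X]` is the extension along `C` of that of `R` (both are `V` of a radical
ideal, and `I R[X]` is radical as `(R ⧸ I)[X]` is reduced). [cite: Matsumura1987, Thm. 23.7 (i)] -/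
theorem stub_regularLocus_polynomial : ∀ (R : Type) [CommRing R] [IsNoetherianRing R],
    (∀ (P : Ideal (Polynomial R)) [P.IsPrime],
      IsRegularLocalRing (Localization.AtPrime P) ↔
        IsRegularLocalRing (Localization.AtPrime (P.comap (Polynomial.C : R →+* Polynomial R)))) ∧
    (IsClosed (regularLocus R)ᶜ →
      PrimeSpectrum.vanishingIdeal (regularLocus (Polynomial R))ᶜ =
        (PrimeSpectrum.vanishingIdeal (regularLocus R)ᶜ).map (Polynomial.C : R →+* Polynomial R)) := by
  intro R _ _
  exact ⟨fun P _ => isRegularLocalRing_localization_polynomial_iff P,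
    vanishingIdeal_compl_regularLocus_polynomial R⟩

end Summit.ResolutionOfSingularities.ResolutionOfSingularities.Theorems.SyzygyFlattening

end
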